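import Summits.ValiantsHypothesis.ValiantsHypothesis.Theorems.KPlusLogSqLawTropicalBWalkDesignTerms
import Literature.Combinatorics.Optimization.GusfieldBreakpointLayeredWidth

/-!
# Route `KPlusLogSqLaw`, crux `TropicalB` (stmt-ValiantsHypothesis-19771) — the NARROW-WALK SECTOR LAW, part 1:
# walks of a layered graph are the paths of a Literature `ParamDAG` (generic interface, no new definitions)

HONEST FRAMING.  Def-free helper file (hand leafhand-val-kpluslogsqlaw-1 g33, 2026-09-01; `--supports stmt-ValiantsHypothesis-19771
--as helper`) toward the registered stubs `stub_tropThin` / `stub_tropFat` / `stub_tropTowerLog` of `Cruxes/TropicalB/Lines/birth.lean`.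
Plumbing for `…TropicalBWalkWidth.lean` (the sector law itself); proves nothing about `TropicalB`, `WeakLifting`, `MatrixDescartes`
(stmt-ValiantsHypothesis-18050) or VP ≠ VNP.

CONTENT.  The layered graph `lay : Fin T → V → V → Option (WEdge K)` of a walk design (`…TropicalBWalkDesignDefs`) is read through a
GENERIC INTERFACE as a parametric DAG `G : Literature.Combinatorics.Optimization.ParamDAG k` on the numbered pairs
`e : Fin (T+1) × V ≃ Fin (k+1)`: `hadj` (arcs = present layer edges), `hw` (arc line = `EL` of the edge), and a partial-cost functional
`pc t y` (line of the first `t` edges of the vertex sequence `y`) axiomatised by `pc0` / `pcS` / `pcC`.  Under this interface: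
* `card_layer_le` — every layer `{a | (e.symm a).1 = L}` has at most `|V|` vertices (the WIDTH of the layering);
* `layer_succ_of_adj` — arcs climb one layer (`(e.symm ·).1` is a layering in the sense of
  `Literature…ParamDAG.Pmax_add_self_le_of_isLayering`);
* `reach_of_pwalk` — a partial walk from `v₀` up to layer `t` is a `Reach` of `t` arcs from `e (0, v₀)` with line `pc t y`;
* `exists_pwalk_of_reach` — conversely every `Reach` from `e (0, v₀)` comes from a partial walk with the same line.
[folklore] (bookkeeping; the instantiation is in part 2)
-/

set_option linter.dupNamespace false
set_option autoImplicit false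

namespace Summit.ValiantsHypothesis.ValiantsHypothesis.Theorems.KPlusLogSqLaw.WalkDesign

open Summit.ValiantsHypothesis.ValiantsHypothesis.Theorems.SymmetroidDescartes.DPR
open Literature.Combinatorics.Optimization
open scoped BigOperators
open Finset

section Interface

variable {V : Type*} [Fintype V] {T K k : ℕ} (lay : Fin T → V → V → Option (WEdge K))
  (e : Fin (T + 1) × V ≃ Fin (k + 1)) (G : ParamDAG k) (EL : Option (WEdge K) → ℝ × ℝ)
  (pc : ℕ → (Fin (T + 1) → V) → ℝ × ℝ)

/-- **Width.**  Every layer of the numbering `e` has at most `|V|` vertices. [folklore] -/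
theorem card_layer_le (L : ℕ) :
    (Finset.univ.filter fun a : Fin (k + 1) => (((e.symm a).1 : Fin (T + 1)) : ℕ) = L).card ≤ Fintype.card V := by
  classical
  have hinj : Set.InjOn (fun a : Fin (k + 1) => (e.symm a).2)
      ↑(Finset.univ.filter fun a : Fin (k + 1) => (((e.symm a).1 : Fin (T + 1)) : ℕ) = L) := by
    intro a ha b hb hab
    simp only [Finset.coe_filter, Finset.mem_univ, true_and, Set.mem_setOf_eq] at ha hb
    have hpair : e.symm a = e.symm b := Prod.ext (Fin.ext (by rw [ha, hb])) hab
    simpa using congrArg e hpair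
  calc (Finset.univ.filter fun a : Fin (k + 1) => (((e.symm a).1 : Fin (T + 1)) : ℕ) = L).card
      = ((Finset.univ.filter fun a : Fin (k + 1) => (((e.symm a).1 : Fin (T + 1)) : ℕ) = L).image
          fun a => (e.symm a).2).card := (Finset.card_image_of_injOn hinj).symm
    _ ≤ (Finset.univ : Finset V).card := Finset.card_le_card (Finset.subset_univ _)
    _ = Fintype.card V := Finset.card_univ

omit [Fintype V] in
/-- **Layering.**  Under the arc interface, arcs climb exactly one layer. [folklore] -/
theorem layer_succ_of_adj (hadj : ∀ a b, G.adj a b ↔ (layerEdge lay (e.symm a) (e.symm b)).isSome) (a b : Fin (k + 1))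
    (hab : G.adj a b) : (((e.symm b).1 : Fin (T + 1)) : ℕ) = (((e.symm a).1 : Fin (T + 1)) : ℕ) + 1 := by
  obtain ⟨ed, hed⟩ := Option.isSome_iff_exists.mp ((hadj a b).1 hab)
  exact layer_of_layerEdge lay hed

omit [Fintype V] in
/-- **Walks are paths of the DAG.**  A partial walk from `v₀` (present edges in the layers `< t`, `t ≤ T`) is a `Reach` of `t` arcs
from `e (0, v₀)` to `e (t, y t)` with line `pc t y`. [folklore] -/
theorem reach_of_pwalk (hadj : ∀ a b, G.adj a b ↔ (layerEdge lay (e.symm a) (e.symm b)).isSome)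
    (hw : ∀ a b, (G.wa a b, G.wb a b) = EL (layerEdge lay (e.symm a) (e.symm b))) (pc0 : ∀ y, pc 0 y = 0)
    (pcS : ∀ (t : ℕ) (ht : t < T) (y : Fin (T + 1) → V), pc (t + 1) y = pc t y + EL (edgeAt lay y ⟨t, ht⟩))
    (v₀ : V) (y : Fin (T + 1) → V) (hy0 : y 0 = v₀) :
    ∀ t (ht : t ≤ T), (∀ s : Fin T, (s : ℕ) < t → (edgeAt lay y s).isSome) →
      G.Reach (e (0, v₀)) (e (⟨t, by omega⟩, y ⟨t, by omega⟩)) t (pc t y)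
  | 0, _, _ => by
      have e0 : (e (⟨0, by omega⟩, y ⟨0, by omega⟩)) = e (0, v₀) := by
        rw [← hy0]; rfl
      rw [e0, pc0]
      exact ParamDAG.Reach.nil
  | t + 1, ht, hy => by
      have ih := reach_of_pwalk hadj hw pc0 pcS v₀ y hy0 t (by omega) (fun s hs => hy s (by omega))
      set s : Fin T := ⟨t, by omega⟩ with hs
      have hedge : (edgeAt lay y s).isSome := hy s (by simp [hs])
      have hle : layerEdge lay (s.castSucc, y s.castSucc) (s.succ, y s.succ) = edgeAt lay y s := by
        rw [layerEdge_succ]; rfl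
      have hadj' : G.adj (e (s.castSucc, y s.castSucc)) (e (s.succ, y s.succ)) := by
        rw [hadj, Equiv.symm_apply_apply, Equiv.symm_apply_apply, hle]
        exact hedge
      have e1 : (⟨t, by omega⟩ : Fin (T + 1)) = s.castSucc := Fin.ext (by simp [hs])
      have e2 : (⟨t + 1, by omega⟩ : Fin (T + 1)) = s.succ := Fin.ext (by simp [hs])
      rw [e1] at ih
      have step := ih.snoc hadj'
      rw [hw, Equiv.symm_apply_apply, Equiv.symm_apply_apply, hle, ← pcS t (by omega)] at step
      rw [e2]
      exact step

omit [Fintype V] in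
/-- **Paths of the DAG are walks.**  A `Reach` of `m` arcs from `e (0, v₀)` comes from a partial walk up to layer `m ≤ T`, ending at the
reached vertex, with the same line. [folklore] -/
theorem exists_pwalk_of_reach (hadj : ∀ a b, G.adj a b ↔ (layerEdge lay (e.symm a) (e.symm b)).isSome)
    (hw : ∀ a b, (G.wa a b, G.wb a b) = EL (layerEdge lay (e.symm a) (e.symm b))) (pc0 : ∀ y, pc 0 y = 0)
    (pcS : ∀ (t : ℕ) (ht : t < T) (y : Fin (T + 1) → V), pc (t + 1) y = pc t y + EL (edgeAt lay y ⟨t, ht⟩))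
    (pcC : ∀ (t : ℕ) (y y' : Fin (T + 1) → V), (∀ s : Fin T, (s : ℕ) < t → edgeAt lay y' s = edgeAt lay y s) → pc t y' = pc t y)
    (v₀ : V) {b : Fin (k + 1)} {m : ℕ} {ℓ : ℝ × ℝ} (hr : G.Reach (e (0, v₀)) b m ℓ) :
    ∃ y : Fin (T + 1) → V, (y 0 = v₀ ∧ ∀ s : Fin T, (s : ℕ) < m → (edgeAt lay y s).isSome) ∧
      (∃ hm : m ≤ T, e.symm b = (⟨m, by omega⟩, y ⟨m, by omega⟩)) ∧ ℓ = pc m y := by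
  induction hr with
  | nil =>
      refine ⟨fun _ => v₀, ⟨rfl, fun s hs => absurd hs (Nat.not_lt_zero _)⟩, ⟨Nat.zero_le _, ?_⟩, ?_⟩
      · rw [Equiv.symm_apply_apply]
        exact Prod.ext (Fin.ext (by simp)) rfl
      · rw [pc0]
  | @snoc a b m ℓ hr hab ih =>
      obtain ⟨y, hP, ⟨hm, ha⟩, hℓ⟩ := ih
      obtain ⟨ed, he⟩ := Option.isSome_iff_exists.mp ((hadj a b).1 hab)
      have ha1 : (((e.symm a).1 : Fin (T + 1)) : ℕ) = m := by rw [ha]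
      have ha2 : (e.symm a).2 = y ⟨m, by omega⟩ := by rw [ha]
      have hlayer : (((e.symm b).1 : Fin (T + 1)) : ℕ) = m + 1 := by
        have := layer_of_layerEdge lay he; omega
      have hmT : m + 1 ≤ T := by have := (e.symm b).1.isLt; omega
      have hs : m < T := by omega
      obtain ⟨hs0, hlay⟩ := lay_of_layerEdge lay he
      have hlay' : lay ⟨m, hs⟩ (y ⟨m, by omega⟩) (e.symm b).2 = some ed := by
        have efin : (⟨(((e.symm a).1 : Fin (T + 1)) : ℕ), hs0⟩ : Fin T) = ⟨m, hs⟩ := Fin.ext ha1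
        rw [efin, ha2] at hlay
        exact hlay
      set y' : Fin (T + 1) → V := Function.update y ⟨m + 1, by omega⟩ (e.symm b).2 with hy'
      have hy'_of_le : ∀ i : Fin (T + 1), (i : ℕ) ≤ m → y' i = y i := by
        intro i hi
        rw [hy', Function.update_of_ne]
        intro hc; rw [hc] at hi; simp at hi
      have hy'_top : y' ⟨m + 1, by omega⟩ = (e.symm b).2 := by rw [hy', Function.update_self]
      have hedges : ∀ s : Fin T, (s : ℕ) < m → edgeAt lay y' s = edgeAt lay y s := by
        intro s hs
        unfold edgeAt
        rw [hy'_of_le s.castSucc (by simp; omega), hy'_of_le s.succ (by simp; omega)]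
      have hnew : edgeAt lay y' ⟨m, hs⟩ = some ed := by
        unfold edgeAt
        have e3 : (Fin.castSucc ⟨m, hs⟩ : Fin (T + 1)) = ⟨m, by omega⟩ := Fin.ext (by simp)
        have e4 : (Fin.succ ⟨m, hs⟩ : Fin (T + 1)) = ⟨m + 1, by omega⟩ := Fin.ext (by simp)
        rw [e3, e4, hy'_of_le _ (by simp), hy'_top]
        exact hlay'
      refine ⟨y', ⟨?_, fun s hs' => ?_⟩, ⟨hmT, ?_⟩, ?_⟩
      · rw [hy'_of_le 0 (by simp)]; exact hP.1
      · rcases Nat.lt_succ_iff_lt_or_eq.mp hs' with hlt | heq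
        · rw [hedges s hlt]; exact hP.2 s hlt
        · have : s = ⟨m, hs⟩ := Fin.ext heq
          rw [this, hnew]; rfl
      · exact Prod.ext (Fin.ext hlayer) hy'_top.symm
      · rw [pcS m hs, hnew, pcC m y y' hedges, ← hℓ, hw, he]

end Interface

end Summit.ValiantsHypothesis.ValiantsHypothesis.Theorems.KPlusLogSqLaw.WalkDesign
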